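import Summits.BirchSwinnertonDyer.Rank1Residual.Additive.KobayashiSignedGenerationTower
import Summits.BirchSwinnertonDyer.Rank1Residual.Additive.ChiEigenPrimeToPDescentGenerator
import HarnessLib

/-!
# Kobayashi's own setting, NO hypothesis left: `K = ℚ`, `K₀ = ℚ(ζ_p)`, `κ` the cyclotomic
# `ℤ_p`-extension — `K_{n,v} = ℚ_p(ζ_{p^{n+1}})` and `E(k_n) = E⁺(k_n) + E⁻(k_n)` (Prop. 8.12 ii))
# for every globally minimal `E/ℚ` with good supersingular reduction, `a_p = 0`, `p` odd
# (cell `b2b-bsdres`, CLASS-CLOSURE lane, class O10 — x1b GEN 34, class lead; file 41 of the local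
# series: the `ℚ`-instances of files 39–40)

HONEST FRAMING (cell `b2b-bsdres`, run/shared/lean/b2b/bsd-rank1-residual/, verbatim in every
file): the goal of the cell is to DELETE the COMBINATION-SHAPED residual classes of the
Birch–Swinnerton-Dyer formula for ALL analytic-rank `≤ 1` elliptic curves over `ℚ` — "full BSD
formula for every rank `≤ 1` curve in class `C`" assembled STRICTLY from published theorems — so
that the rank-`≤ 1` remainder becomes exactly the CONSTRUCTION-SHAPED classes, which are TYPED
(missing-input `Prop`s), NOT attempted. This is not "finishing BSD". CLASS-CLOSURE lane: prove
what is provable now; shrink each hard class to its core with data; no claim beyond stated classes;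
research routes on CONSTRUCTION-SHAPED X12 / O10; census / instrument output = EVIDENCE / conjecture
items, NEVER a Literature fact; `RESIDUAL-MAP.md` marks change only by signed lines. THIS FILE:
TOOL THEOREMS ONLY — no definition, no named Literature fact, no Summits-side fact `def … : Prop`,
no `sorry`, axioms standard; nothing is booked; no label / mark / count / sub-cell moves; O10 stays
OPEN / CONSTRUCTION-SHAPED; nothing about `BSD(W, p)` of any pair is claimed.

## Content (`F = ℚ(ζ_p)` any `p`-th cyclotomic number field, `κ : ZpExtension ℚ p` cyclotomic —
## e.g. the CONSTRUCTED `CyclotomicZp.zpExtension p` — `ι : ℚ̄ → ℚ̄_p`, `p` odd)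

* `localSubgroupOfEmb_towerSubgroup_eq_stab_rat`: **`Gal(ℚ̄_p / (ℚ(ζ_p)·ℚ_n)_v) = Stab(ζ_{p^{n+1}})`**,
  i.e. Kobayashi's `k_n = ℚ_p(ζ_{p^{n+1}})` for cc-typer-6's tower (F9 with its three hypotheses
  supplied: `zeta_spec`, `[ℚ(ζ_p) : ℚ] = p − 1`, normality); `…_zpExtension` for the constructed `κ`.
* `localFixedPointsOfEmb_towerSubgroup_le_sup_towerSigned_rat`: **`E(k_n) ≤ E⁺(k_n) ⊔ E⁻(k_n)`** for
  every globally minimal elliptic `V/ℚ` with good reduction at `p` and `a_p(V) = 0` — Kobayashi's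
  Prop. 8.12 ii) (generation half) AS PRINTED, hypothesis-free; `…_zpExtension`.
* `not_mem_localKummerOverOfEmb_neg_one_of_kummer_generator_towerSubgroup_rat`: the class-level
  transversality (T) of the η-odd Kummer line (`u(p) = 0` of the (C3_η) anatomy) in the same setting.

References: [Kobayashi2003] §2 p. 4, Prop. 8.7, Prop. 8.12 ii), §8.4; [Washington1997] §13.1.
-/

noncomputable section

open scoped Classical

namespace Summit.BirchSwinnertonDyer.Rank1Residual.Additive

open Literature.NumberTheory.EllipticCurves Literature.NumberTheory.GaloisRepresentations
  Literature.NumberTheory.EllipticCurves.Kobayashi2003 Literature.NumberTheory.EllipticCurves.CyclotomicZp ZpExtension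
  WeierstrassCurve PadicCyclotomicTower

variable (p : ℕ) [hp : Fact p.Prime] (F : Type) [Field F] [NumberField F] [hF : IsCyclotomicExtension {p} ℚ F]
  (ι : AlgebraicClosure ℚ →ₐ[ℚ] AlgebraicClosure ℚ_[p])

/-- `[ℚ(ζ_p) : ℚ] ≤ p − 1` (equality, `IsCyclotomicExtension.finrank`). [folklore] -/
theorem finrank_cyclotomic_le : Module.finrank ℚ F ≤ p - 1 := by
  rw [IsCyclotomicExtension.finrank F (Polynomial.cyclotomic.irreducible_rat hp.out.pos), Nat.totient_prime hp.out]

variable {p} in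
/-- **Kobayashi's `k_n = ℚ_p(ζ_{p^{n+1}})`, kernel form**: for `κ : ZpExtension ℚ p` cyclotomic,
`F = ℚ(ζ_p)`, `p` odd and any `ι : ℚ̄ → ℚ̄_p`, the local subgroup of `Gal(ℚ̄/F·ℚ_n^κ)` at `ι` is the
stabiliser of `ζ_{p^{n+1}}` in `Gal(ℚ̄_p/ℚ_p)`. [cite: Kobayashi2003, §2 p. 4 (k_n = ℚ_p(ζ_{p^{n+1}}))] -/
theorem localSubgroupOfEmb_towerSubgroup_eq_stab_rat (κ : ZpExtension ℚ p) (hp2 : p ≠ 2)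
    (hκ : κ.IsCyclotomic) (n : ℕ) : localSubgroupOfEmb (towerSubgroup κ F n) ι = stab p (n + 1) := by
  haveI := normal_galRange_cyclotomic p F
  exact localSubgroupOfEmb_towerSubgroup_eq_stab F ι hp2 hκ ⟨_, IsCyclotomicExtension.zeta_spec p ℚ F⟩
    (by rw [index_galRange_cyclotomic p F]) n

/-- The same for the CONSTRUCTED cyclotomic `ℤ_p`-extension `κ_cyc = CyclotomicZp.zpExtension p`
(`isCyclotomic_zpExtension`). [cite: Kobayashi2003, §2 p. 4] [cite: Washington1997, §13.1] -/
theorem localSubgroupOfEmb_towerSubgroup_zpExtension_eq_stab (hp2 : p ≠ 2) (n : ℕ) :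
    localSubgroupOfEmb (towerSubgroup (CyclotomicZp.zpExtension p) F n) ι = stab p (n + 1) :=
  localSubgroupOfEmb_towerSubgroup_eq_stab_rat F ι (CyclotomicZp.zpExtension p) hp2 (isCyclotomic_zpExtension p) n

variable {p} in
/-- **Kobayashi Prop. 8.12 ii) (generation half) AS PRINTED, hypothesis-free**: for a globally
minimal elliptic `V/ℚ` with good reduction at the odd prime `p` and `a_p(V) = 0`, `κ` cyclotomic,
`F = ℚ(ζ_p)` and any `ι`: `E(k_n) ≤ E⁺(k_n) ⊔ E⁻(k_n)` at every layer of cc-typer-6's tower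
(`k_n = ℚ_p(ζ_{p^{n+1}})`). [cite: Kobayashi2003, Prop. 8.12] -/
theorem localFixedPointsOfEmb_towerSubgroup_le_sup_towerSigned_rat (κ : ZpExtension ℚ p) (hp2 : p ≠ 2)
    (hκ : κ.IsCyclotomic) (V : WeierstrassCurve ℚ) [V.IsElliptic] [V.IsGloballyMinimal]
    (hgood : V.HasGoodReductionAtPrime p) (hap : V.frobeniusTrace p = 0) (n : ℕ) :
    localFixedPointsOfEmb ι V (towerSubgroup κ F n) ≤
      towerSignedLocalPointsOfEmb (towerSubgroup κ F) ι V 1 n ⊔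
        towerSignedLocalPointsOfEmb (towerSubgroup κ F) ι V (-1) n := by
  haveI := normal_galRange_cyclotomic p F
  haveI : IsGalois ℚ F := IsCyclotomicExtension.isGalois {p} ℚ F
  exact localFixedPointsOfEmb_towerSubgroup_le_sup_towerSigned_of_goodSupersingular F ι V hp2 hκ
    ⟨_, IsCyclotomicExtension.zeta_spec p ℚ F⟩ (finrank_cyclotomic_le p F) V hgood hap rfl n

/-- The same EQUALITY `E⁺(k_n) ⊔ E⁻(k_n) = E(k_n)` for the constructed `κ_cyc`.
[cite: Kobayashi2003, Prop. 8.12] -/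
theorem sup_towerSigned_towerSubgroup_zpExtension_eq (hp2 : p ≠ 2)
    (V : WeierstrassCurve ℚ) [V.IsElliptic] [V.IsGloballyMinimal]
    (hgood : V.HasGoodReductionAtPrime p) (hap : V.frobeniusTrace p = 0) (n : ℕ) :
    towerSignedLocalPointsOfEmb (towerSubgroup (CyclotomicZp.zpExtension p) F) ι V 1 n ⊔
        towerSignedLocalPointsOfEmb (towerSubgroup (CyclotomicZp.zpExtension p) F) ι V (-1) n =
      localFixedPointsOfEmb ι V (towerSubgroup (CyclotomicZp.zpExtension p) F n) :=
  le_antisymm (sup_le (towerSignedLocalPointsOfEmb_le _ ι V 1 n) (towerSignedLocalPointsOfEmb_le _ ι V (-1) n))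
    (localFixedPointsOfEmb_towerSubgroup_le_sup_towerSigned_rat F ι (CyclotomicZp.zpExtension p) hp2
      (isCyclotomic_zpExtension p) V hgood hap n)

variable {p} in
/-- **Class-level transversality (T) in Kobayashi's setting, hypothesis-free** (`u(p) = 0` of the
(C3_η) anatomy): for `V/ℚ` globally minimal with good reduction at odd `p`, `a_p(V) = 0`, `κ`
cyclotomic, `F = ℚ(ζ_p)`: an η-odd `g ∈ E(k_0)` not `p`-divisible in `E(k_0)` has no class of
`H¹(Gal(ℚ̄/F·ℚ_n), E[p^∞])` with Kummer restriction `g ⊗ p^{−1}` inside the `E⁻(k_n)` condition.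
[cite: Kobayashi2003, Def. 2.1 (p. 5), Prop. 8.12 ii) (pp. 17–18), Prop. 8.7 (p. 16)] -/
theorem not_mem_localKummerOverOfEmb_neg_one_of_kummer_generator_towerSubgroup_rat (κ : ZpExtension ℚ p)
    (hp2 : p ≠ 2) (hκ : κ.IsCyclotomic) (V : WeierstrassCurve ℚ) [V.IsElliptic] [V.IsGloballyMinimal]
    (hgood : V.HasGoodReductionAtPrime p) (hap : V.frobeniusTrace p = 0) (n : ℕ)
    {g : localPoints V ℚ_[p]} (hg : g ∈ localFixedPointsOfEmb ι V (towerSubgroup κ F 0))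
    {τ₀ : Field.absoluteGaloisGroup ℚ_[p]} (hτ₀ : τ₀ • g = -g)
    (hndiv : ∀ S ∈ localFixedPointsOfEmb ι V (towerSubgroup κ F 0), g ≠ p • S)
    {c : V.subgroupH1 p (towerSubgroup κ F n)}
    (hcg : ∃ (ψ : contOneCocycles (discreteTopRep (towerSubgroup κ F n) (V.geomPrimaryTorsion p)))
      (Q₁ : localPoints V ℚ_[p]) (j : ℕ),
      oneCocycleClass (discreteTopRep (towerSubgroup κ F n) (V.geomPrimaryTorsion p)) ψ = c ∧
        p ^ (j + 1) • Q₁ = p ^ j • g ∧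
        ∀ τ : localSubgroupOfEmb (towerSubgroup κ F n) ι,
          pointsMapOfEmb V ι ((ψ.1 (resGalSubgroupOfEmb (towerSubgroup κ F n) ι τ) :
              V.geomPrimaryTorsion p) : V.geomPoints) =
            (τ : Field.absoluteGaloisGroup ℚ_[p]) • Q₁ - Q₁) :
    c ∉ localKummerOverOfEmb V p (towerSubgroup κ F n) ι
      (towerSignedLocalPointsOfEmb (towerSubgroup κ F) ι V (-1) n) := by
  haveI := normal_galRange_cyclotomic p F
  haveI : IsGalois ℚ F := IsCyclotomicExtension.isGalois {p} ℚ F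
  exact not_mem_localKummerOverOfEmb_neg_one_of_kummer_generator_towerSubgroup_of_goodSupersingular' F ι V hp2 hκ
    ⟨_, IsCyclotomicExtension.zeta_spec p ℚ F⟩ (finrank_cyclotomic_le p F) V hgood hap rfl n hg hτ₀ hndiv hcg

end Summit.BirchSwinnertonDyer.Rank1Residual.Additive

end
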